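import Literature.MathematicalPhysics.QuantumFieldTheory.Balaban1983to89.T4FirstOrderSize
import Literature.MathematicalPhysics.QuantumFieldTheory.Balaban1983to89.B7Prop6Bound
import Literature.MathematicalPhysics.QuantumFieldTheory.Dimock2015.AnalyticLipschitz

/-!
# T4AxialChain — the chained axial-gauge estimate behind `MeanLipschitz`'s deviation (cell `pub-balaban`,
T4-DAG v4 §5 row T4-O3.E-i′-Oβ3, obligation O-β3 of `t4/T4-EST-O3Ei1.md` §4; XREAD + EST shape)

HONEST FRAMING (cell `pub-balaban`, T4-DAG PAGE 1).  The cell's T4 target is the existence AND uniqueness of the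
continuum limit of Bałaban's unit-scale averaged loop expectations on a finite torus — a constructive-QFT statement
strictly beyond ultraviolet stability ([Balaban1989LargeFieldII] Thm 1 p. 355); it is NOT the Yang–Mills mass gap and
NOT the Clay problem.  This module serves ONE hypothesis slot of the sibling module `T4FirstOrderSize`: the deviation
`dev u` and the constant `lip` in `T4FirstOrderSize.MeanLipschitz` ("‖m u b − m u₀ b‖ ≤ lip · dev u": Lipschitz
dependence of a conditional mean field on the exterior configuration `u`, relative to a flat reference `u₀`).  The
cell's estimate record asks where the CHAINED axial-gauge estimate — "the axial-gauge potential of a small-curvature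
configuration is O(chain length × plaquette bound) along the comb of contours from an initial point" — is PRINTED, with
which dependence on the chain length, and what survives for COMPLEX (G^c-valued) configurations.  Answer recorded here:
* PRINTED, for unitary configurations, LINEAR in the ℓ¹-distance to the initial point (verbatim loci below): the
  telescoping is additive because unitary factors have operator norm 1.  Kernel form: `norm_mul_sub_one_le_add`,
  `norm_oprod_sub_one_le_mul` (§1, §3).
* For G^c-valued configurations NO chained estimate is printed on the pages read (the potential bounds on cubes are
  CONDITIONS in the definitions of the analyticity spaces, [Balaban1987RG1] (1.11)/(1.12) p. 262 and
  [Balaban1989LargeFieldI] (1.65)/(1.67)/(1.69) pp. 190–191, not lemmas).  What elementary algebra gives instead is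
  recorded as kernel lemmas [folklore]: the multiplicative telescoping `‖W·P − 1‖ ≤ (1 + ‖W − 1‖)(1 + ‖P − 1‖) − 1`
  (REUSED from the sibling `B7Prop6Bound.mul_sub_one_norm_le`, with its ordered product `B7Prop6Bound.oprod` as the
  chain) giving `‖oprod P m − 1‖ ≤ (1 + η)^m − 1` (`norm_oprod_sub_one_le_pow`), its linearisation `≤ 2·m·η` while
  `m·η ≤ 1` (`norm_oprod_sub_one_le_two_mul`), and the conjugation cost of a NON-unitary gauge transformation
  `‖u P u⁻¹ − 1‖ ≤ ‖u‖‖u⁻¹‖‖P − 1‖` (`norm_conj_sub_one_le`; for isometric `u` this is the inequality half of the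
  printed "|V₀(∂p) − 1| = |V(∂p) − 1|").
* HOW `MeanLipschitz` IS THEN SUPPLIED (§5, the cell's construct, NOT PRINTED): not by a Cauchy estimate in a ball
  about the flat point (the real deviation may exceed the complex thickening), but along the REAL SEGMENT from the flat
  representative to the actual one inside the tube "real small field × complex thickening of width α₁": for an analytic,
  bounded slice `g : ℂ → F` through `g 0 = m u₀ b`, `g 1 = m u b` whose domain contains the closed discs of radius
  `α₁ / dev u` about `[0, 1]`, `‖m u b − m u₀ b‖ ≤ (4·sup‖g‖/α₁)·dev u` — `Dimock2015.real_param_lipschitz` (Cauchy on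
  discs of the margin) with `ϱ = α₁/dev u` (`meanLipschitz_of_segment`).  Hence `lip = 4·sup|m|/α₁` and `dev u` = the sup norm of the axial-gauge
  potential of `u` over the region, which the chain lemmas bound by (chain length in bonds) × (plaquette bound) — LINEAR
  in the diameter `100·M·R_j` of the region, times the relative flatness `φ^{k−j}` of a scale-`k` small field measured
  in scale-`j` units (`chainDeviation_eq`).  The sibling's slot `dev j ≤ α₀·(100·M·R_j)²·φ^{K−j}`
  (`T4FirstOrderSize.sizeShape_firstOrder`, hypothesis `hdev`) is the cruder QUADRATIC count; the linear bound implies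
  it as soon as `100·M·R_j ≥ 1` (`hdev_of_linear`) — no objection, a remark on constants only.
Value = located printed loci + kernel bookkeeping of elementary normed-ring inequalities + a typed hand-off; NOT summit
progress, and NO statement about Bałaban's renormalization-group objects is asserted: every analytic input (existence,
analyticity, boundedness and gauge covariance of the slices `g`) is a HYPOTHESIS on abstract data.

PRINTED LOCI (verbatim, journal page numbers; read on the rendered pages / text layers named at the end; the
manuscripts under audit are quoted for CONTEXT and for this ELEMENTARY, undisputed step only).
* [Balaban1985Averaging] (CMP 98) pp. 24–25, between (44) and (47) — THE MODEL STATEMENT.  "We assume that a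
  configuration V defined on a unit lattice Ω′ satisfies |V(∂p) − 1| < α₀, p ⊂ Ω′, (44)" … "let us introduce locally
  the axial gauge with the initial point y. This means that we take the contours Γ_{y,x} = [y, (y₁, …, y_{d−1}, x_d)]
  ∪ … ∪ [(y₁, x₂, …, x_d), x]" … "V₀ = V^{v₀} satisfies the conditions V₀(Γ_{y,x}) = 1" … "|V₀(∂p) − 1| =
  |V(∂p) − 1| < α₀ … (45)" … "The conditions V₀(Γ_{y,x}) = 1 imply V₀(x, x + e₁) = 1, |V₀(x, x + e₂) − 1| <
  |x₁ − y₁|α₀, |V₀(x, x + e₃) − 1| < (|x₁ − y₁| + |x₂ − y₂|)α₀, …, |V₀(x, x + e_μ) − 1| < (|x₁ − y₁| + … +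
  |x_{μ−1} − y_{μ−1}|)α₀, μ = 2, …, d, for x in the neighborhood of y." … "then for b ⊂ Δ(p′) we have |V₀,b − 1| <
  |b₋ − y|α₀ ≦ dLα₀, hence V₀,b = e^{iA_b} and |A_b| < 2|b₋ − y|α₀ ≦ 2dLα₀. For c ⊂ ∂p′ … |V₀(Γ_{c,x}) − 1| ≦
  Σ_{b⊂Γ_{c,x}} |V₀,b − 1| < |Γ_{c,x}|dLα₀ < (2d + 1)LdLα₀ = O(1)L²α₀".
  [cite: Balaban1985Averaging, (44)–(47) pp. 24–25]
* [Balaban1985RegularSpaces] (CMP 99) p. 79, Lemma 1 — the same count relative to a background: "Lemma 1. Let V₀, V′V₀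
  satisfy the condition (1.7) for k = 1 and L arbitrary, and let (R(V₀)V′)(Γ_{y,x}) = 1 for x ∈ B(y),
  |\overline{V′V₀} − V̄₀| < α₁ on Ω₁^{(1)}. (1.24) [typography: ONE overline spanning the product V′V₀] Then for α₀, α₁
  small the configuration V′ is also small, more precisely we have the bound |V′ − 1| < 4d²α₀ + α₁ on Ω₁. (1.25)",
  proof: "From (1.22) and the assumptions we have |(∂_{V₀}V′)(p) − 1| ≦ |V₀(∂p) − 1| + |(V′V₀)(∂p) − 1| < 2α₀L⁻². (1.26)
  The conditions (R₀V′)(Γ_{y,x}) = 1, x ∈ B(y), imply V′_b = 1 for b ⊂ Γ_{y,x}. This and the above estimate imply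
  |V′_b − 1| < (d − 1)(L − 1)2α₀L⁻² for b ⊂ B(y) by the same reasoning as in [3] (between (44) and (46))."
  ([3] = [Balaban1985Averaging].)  [cite: Balaban1985RegularSpaces, Lemma 1
  (1.24)–(1.26) p. 79]
* [Balaban1989LargeFieldI] (CMP 122) p. 197 — the count over a large cube, one factor M per side: "The configuration
  M^k(U₀) = V_Λ satisfies the regularity condition (1.78). We fix for it the axial gauge in Λ^{(k)}, hence the field V_Λ
  is small inside Λ^{(k)}. More precisely, it satisfies the bound |V_Λ(b) − 1| < O(1)B₅M⁶ε_k for b ⊂ Λ^{(k)}. (1.83)"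
  (with (1.78) p. 194, Proposition 1: "|V_Λ(∂p′) − 1| < B₅M⁵ε for p′ ∈ Λ"); and p. 196, stated without proof for the
  tree-graph gauge on B₀: "We can prove that it satisfies |V′ − 1| < O(1)M²NR_k⁴ε_k on B₀".
  [cite: Balaban1989LargeFieldI, (1.78) p. 194, (1.83) p. 197, p. 196]
* WHERE THE POTENTIAL BOUNDS ARE CONDITIONS, NOT LEMMAS.  [Balaban1987RG1] (CMP 109) p. 262, the definition of the
  spaces of configurations 𝐔 = U′U on which analyticity is asserted: (i) U real with small curvature (1.11) and, "for
  each cube □ ⊂ X of a size O(1)LM", in a gauge "U^u = exp iξA, |A|, |∇^ξA| < O(1)LMBα₀ on □" (1.12) "with a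
  sufficiently large constant B (it will be determined later)"; (ii) "U′ = exp iξA′, A′ has values in the algebra 𝐠^c,
  |A′|, |∇^ξ_U A′| < α₁ on X. (1.13)"; (iii) the complex curvature condition (1.14).  [Balaban1989LargeFieldI]
  pp. 190–191 (1.65)/(1.67)/(1.69): the same potential bounds on cubes "of the size CML^mη", and "The constant C
  above is a positive integer. It is usually small, because of geometric constraints on the cubes, for example we can
  assume that C ≦ 2. The constant B is a fixed absolute constant, for example we can take the constant B = B₃ from
  Theorem 1 [16]."  [cite: Balaban1987RG1, (1.11)–(1.14) p. 262]
  [cite: Balaban1989LargeFieldI, (1.65)–(1.69) pp. 190–191]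
NOT PRINTED on any page read (recorded so that no reader takes the kernel lemmas below for quotations): (a) a chained
estimate for G^c-valued configurations derived from the complex curvature condition alone; (b) the identification of
`MeanLipschitz`'s `dev` with an axial-gauge potential norm and the segment-Cauchy step of §5 — these are the CELL'S
construction (referee record `t4/T4-REF-O3.md` V5 (ii)), typed here as hypotheses → conclusion.

Renders / text layers read: CMP 98 pp. 24–26 (PDF pp. 8–10), CMP 99 p. 79 (PDF p. 5, ×2 render), CMP 109 pp. 262–264
(PDF pp. 14–16), CMP 122 pp. 190–191, 194, 196–197 (PDF pp. 16–17, 20, 22–23; pp. 194, 197 ×2 renders), CMP 102 p. 301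
(PDF p. 25).

REVISION v1.1 (DOCFIX, docstring-only; every declaration byte-identical to v1 p181016): after the cross-read XREAD
T4AxialChain v1 ok (b2b-balaban-pv14-g5, GAPS C-pv14-35) — (R1) locator of (1.78) corrected to p. 194, Proposition 1
of [Balaban1989LargeFieldI] (text unchanged, verified on the ×2 render of PDF p. 20); (R2) quotation typography: B8
(1.24) carries ONE overline over the product V′V₀, and B12 (1.13) is now quoted in full ("A′ has values in the algebra
𝐠^c", covariant gradient ∇^ξ_U).
-/

namespace Literature.MathematicalPhysics.QuantumFieldTheory.Balaban1983to89.T4AxialChain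

open Set Metric

/-! ## §1  Telescoping of products near `1` in a normed ring (the algebra of "|V₀(Γ) − 1| ≦ Σ_b |V₀,b − 1|") -/

section Telescoping

variable {R : Type*} [NormedRing R]

/-- ADDITIVE telescoping for a contraction factor: `‖P‖ ≤ 1 ⇒ ‖P·W − 1‖ ≤ ‖W − 1‖ + ‖P − 1‖` — the step behind the
printed "|V₀(x, x + e_μ) − 1| < (|x₁ − y₁| + … + |x_{μ−1} − y_{μ−1}|)α₀" for unitary configurations.
[cite: Balaban1985Averaging, (44)–(46) pp. 24–25] -/
theorem norm_mul_sub_one_le_add {P : R} (hP : ‖P‖ ≤ 1) (W : R) : ‖P * W - 1‖ ≤ ‖W - 1‖ + ‖P - 1‖ := by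
  have h : P * W - 1 = P * (W - 1) + (P - 1) := by noncomm_ring
  rw [h]
  calc ‖P * (W - 1) + (P - 1)‖ ≤ ‖P * (W - 1)‖ + ‖P - 1‖ := norm_add_le _ _
    _ ≤ ‖P‖ * ‖W - 1‖ + ‖P - 1‖ := by gcongr; exact norm_mul_le _ _
    _ ≤ 1 * ‖W - 1‖ + ‖P - 1‖ := by gcongr
    _ = ‖W - 1‖ + ‖P - 1‖ := by rw [one_mul]

/-- The same with the contraction factor on the RIGHT (the order of `B7Prop6Bound.oprod`):
`‖P‖ ≤ 1 ⇒ ‖W·P − 1‖ ≤ ‖W − 1‖ + ‖P − 1‖`.  (Without the norm restriction the multiplicative form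
`‖W·P − 1‖ ≤ (1 + ‖W − 1‖)(1 + ‖P − 1‖) − 1` is the sibling's `B7Prop6Bound.mul_sub_one_norm_le`, reused below.)
[cite: Balaban1985Averaging, (44)–(46) pp. 24–25] -/
theorem norm_mul_sub_one_le_add' (W : R) {P : R} (hP : ‖P‖ ≤ 1) : ‖W * P - 1‖ ≤ ‖W - 1‖ + ‖P - 1‖ := by
  have h : W * P - 1 = (W - 1) * P + (P - 1) := by noncomm_ring
  rw [h]
  calc ‖(W - 1) * P + (P - 1)‖ ≤ ‖(W - 1) * P‖ + ‖P - 1‖ := norm_add_le _ _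
    _ ≤ ‖W - 1‖ * ‖P‖ + ‖P - 1‖ := by gcongr; exact norm_mul_le _ _
    _ ≤ ‖W - 1‖ * 1 + ‖P - 1‖ := by gcongr
    _ = ‖W - 1‖ + ‖P - 1‖ := by rw [mul_one]

/-- The printed contour telescoping "|V₀(Γ_{c,x}) − 1| ≦ Σ_{b⊂Γ_{c,x}} |V₀,b − 1|" for factors of norm `≤ 1`.
[cite: Balaban1985Averaging, between (46) and (47) p. 25] -/
theorem norm_prod_sub_one_le_sum :
    ∀ {l : List R}, (∀ x ∈ l, ‖x‖ ≤ 1) → ‖l.prod - 1‖ ≤ (l.map fun x => ‖x - 1‖).sum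
  | [], _ => by simp
  | a :: l, h => by
      rw [List.prod_cons, List.map_cons, List.sum_cons]
      have ha : ‖a‖ ≤ 1 := h a (by simp)
      have ih := norm_prod_sub_one_le_sum (l := l) fun x hx => h x (by simp [hx])
      calc ‖a * l.prod - 1‖ ≤ ‖l.prod - 1‖ + ‖a - 1‖ := norm_mul_sub_one_le_add ha _
        _ ≤ (l.map fun x => ‖x - 1‖).sum + ‖a - 1‖ := by gcongr
        _ = ‖a - 1‖ + (l.map fun x => ‖x - 1‖).sum := add_comm _ _

/-- `(1 + η)^m ≤ exp(m·η)` for `η ≥ 0`. [folklore] -/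
theorem one_add_pow_le_exp {η : ℝ} (hη : 0 ≤ η) (m : ℕ) : (1 + η) ^ m ≤ Real.exp (m * η) := by
  rw [Real.exp_nat_mul]
  exact pow_le_pow_left₀ (by linarith) (by linarith [Real.add_one_le_exp η]) m

end Telescoping

/-! ## §2  Gauge transformations that are not isometries: the conjugation cost -/

section Conjugation

variable {R : Type*} [NormedRing R]

/-- `u·P·u⁻¹ − 1 = u·(P − 1)·u⁻¹` for a unit `u`. [folklore] -/
theorem conj_sub_one (u : Rˣ) (P : R) : (u : R) * P * ↑u⁻¹ - 1 = (u : R) * (P - 1) * ↑u⁻¹ := by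
  rw [mul_sub, sub_mul, mul_one, Units.mul_inv]

/-- CONJUGATION COST: `‖u·P·u⁻¹ − 1‖ ≤ ‖u‖·‖u⁻¹‖·‖P − 1‖` — a plaquette variable seen through a G^c-valued (non-unitary)
gauge transformation is within `‖u‖‖u⁻¹‖ × (its curvature bound)` of `1`. [folklore] -/
theorem norm_conj_sub_one_le (u : Rˣ) (P : R) :
    ‖(u : R) * P * ↑u⁻¹ - 1‖ ≤ ‖(u : R)‖ * ‖((u⁻¹ : Rˣ) : R)‖ * ‖P - 1‖ := by
  rw [conj_sub_one]
  calc ‖(u : R) * (P - 1) * ↑u⁻¹‖ ≤ ‖(u : R) * (P - 1)‖ * ‖((u⁻¹ : Rˣ) : R)‖ := norm_mul_le _ _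
    _ ≤ ‖(u : R)‖ * ‖P - 1‖ * ‖((u⁻¹ : Rˣ) : R)‖ := by gcongr; exact norm_mul_le _ _
    _ = ‖(u : R)‖ * ‖((u⁻¹ : Rˣ) : R)‖ * ‖P - 1‖ := by ring

/-- ISOMETRIC gauge transformations cost nothing: `‖u‖, ‖u⁻¹‖ ≤ 1 ⇒ ‖u·P·u⁻¹ − 1‖ ≤ ‖P − 1‖` — the inequality half of the
printed "|V₀(∂p) − 1| = |V(∂p) − 1|" (gauge invariance of the plaquette bound for G-valued transformations).
[cite: Balaban1985Averaging, (45) p. 24] -/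
theorem norm_conj_sub_one_le_of_norm_le_one (u : Rˣ) (P : R) (hu : ‖(u : R)‖ ≤ 1)
    (hu' : ‖((u⁻¹ : Rˣ) : R)‖ ≤ 1) : ‖(u : R) * P * ↑u⁻¹ - 1‖ ≤ ‖P - 1‖ := by
  refine (norm_conj_sub_one_le u P).trans ?_
  calc ‖(u : R)‖ * ‖((u⁻¹ : Rˣ) : R)‖ * ‖P - 1‖ ≤ 1 * 1 * ‖P - 1‖ := by gcongr
    _ = ‖P - 1‖ := by ring

/-- A complex bond variable `𝐔(b) = U′(b)·U(b)` with `‖U(b)‖ ≤ 1` (unitary part) is bounded by its "imaginary" factor: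
`‖U′·U‖ ≤ ‖U′‖`. [folklore] -/
theorem norm_mul_le_of_norm_le_one {U' U : R} (hU : ‖U‖ ≤ 1) : ‖U' * U‖ ≤ ‖U'‖ :=
  (norm_mul_le _ _).trans (mul_le_of_le_one_right (norm_nonneg _) hU)

/-- TRANSPORTER NORM along a contour of `|l|` bonds each of norm `≤ exp τ` (e.g. `τ` = the bound on the imaginary
potential `ξ|A′|` per bond): `‖∏ l‖ ≤ exp(|l|·τ)`. [folklore] -/
theorem norm_prod_le_exp_mul_length [NormOneClass R] {τ : ℝ} :
    ∀ {l : List R}, (∀ x ∈ l, ‖x‖ ≤ Real.exp τ) → ‖l.prod‖ ≤ Real.exp (l.length * τ)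
  | [], _ => by simp
  | a :: l, h => by
      rw [List.prod_cons, List.length_cons]
      have ha : ‖a‖ ≤ Real.exp τ := h a (by simp)
      have ih := norm_prod_le_exp_mul_length (l := l) fun x hx => h x (by simp [hx])
      calc ‖a * l.prod‖ ≤ ‖a‖ * ‖l.prod‖ := norm_mul_le _ _
        _ ≤ Real.exp τ * Real.exp (l.length * τ) := mul_le_mul ha ih (norm_nonneg _) (Real.exp_pos _).le
        _ = Real.exp ((l.length + 1 : ℕ) * τ) := by rw [← Real.exp_add]; push_cast; ring_nf

/-- The conjugation factor of a gauge transformation whose transporter and inverse transporter both run over `n` bonds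
of norm `≤ exp τ`: `‖u‖·‖u⁻¹‖ ≤ exp(2nτ)`. [folklore] -/
theorem norm_mul_norm_inv_le_exp {u : Rˣ} {n : ℕ} {τ : ℝ} (h1 : ‖(u : R)‖ ≤ Real.exp (n * τ))
    (h2 : ‖((u⁻¹ : Rˣ) : R)‖ ≤ Real.exp (n * τ)) :
    ‖(u : R)‖ * ‖((u⁻¹ : Rˣ) : R)‖ ≤ Real.exp (2 * n * τ) := by
  calc ‖(u : R)‖ * ‖((u⁻¹ : Rˣ) : R)‖ ≤ Real.exp (n * τ) * Real.exp (n * τ) :=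
        mul_le_mul h1 h2 (norm_nonneg _) (Real.exp_pos _).le
    _ = Real.exp (2 * n * τ) := by rw [← Real.exp_add]; ring_nf

end Conjugation

/-! ## §3  The axial chain: a bond variable moved off the gauge tree one plaquette at a time -/

section Chain

variable {R : Type*} [NormedRing R]

open B7Prop6Bound (oprod mul_sub_one_norm_le)

/-! THE COMB RECURSION of the local axial gauge (contours `Γ_{y,x}`): the bond variable at distance `0` from the gauge
tree is `1` ("V₀(Γ_{y,x}) = 1 imply V₀(x, x + e₁) = 1"), and moving the bond one lattice step across the `i`-th
plaquette met multiplies it by that plaquette variable `P i` (in the gauge).  Abstract data: the sequence of plaquette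
variables met; the chain after `m` steps is the sibling's ORDERED PRODUCT `B7Prop6Bound.oprod P m = P 0 · … · P (m−1)`
(`oprod P (m+1) = oprod P m · P m`). -/

/-- THE PRINTED (unitary) CHAIN ESTIMATE, LINEAR in the number of steps: factors of norm `≤ 1` within `α₀` of `1` ⇒
`‖oprod P m − 1‖ ≤ m·α₀` — "|V₀(x, x + e_μ) − 1| < (|x₁ − y₁| + … + |x_{μ−1} − y_{μ−1}|)α₀", "|V₀,b − 1| <
|b₋ − y|α₀ ≦ dLα₀".  [cite: Balaban1985Averaging, (44)–(46) pp. 24–25] -/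
theorem norm_oprod_sub_one_le_mul {P : ℕ → R} {α₀ : ℝ} :
    ∀ {m : ℕ}, (∀ i < m, ‖P i‖ ≤ 1) → (∀ i < m, ‖P i - 1‖ ≤ α₀) → ‖oprod P m - 1‖ ≤ m * α₀
  | 0, _, _ => by simp [oprod]
  | m + 1, h1, h => by
      rw [oprod]
      have ih := norm_oprod_sub_one_le_mul (m := m) (fun i hi => h1 i (Nat.lt_succ_of_lt hi))
        fun i hi => h i (Nat.lt_succ_of_lt hi)
      calc ‖oprod P m * P m - 1‖ ≤ ‖oprod P m - 1‖ + ‖P m - 1‖ :=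
            norm_mul_sub_one_le_add' _ (h1 m m.lt_succ_self)
        _ ≤ m * α₀ + α₀ := add_le_add ih (h m m.lt_succ_self)
        _ = ((m + 1 : ℕ) : ℝ) * α₀ := by push_cast; ring

/-- THE GENERAL (G^c-valued) CHAIN ESTIMATE: factors within `η` of `1`, no norm restriction ⇒
`‖oprod P m − 1‖ ≤ (1 + η)^m − 1` (step: `B7Prop6Bound.mul_sub_one_norm_le`). [folklore] -/
theorem norm_oprod_sub_one_le_pow {P : ℕ → R} {η : ℝ} (hη : 0 ≤ η) :
    ∀ {m : ℕ}, (∀ i < m, ‖P i - 1‖ ≤ η) → ‖oprod P m - 1‖ ≤ (1 + η) ^ m - 1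
  | 0, _ => by simp [oprod]
  | m + 1, h => by
      rw [oprod, pow_succ]
      have ih := norm_oprod_sub_one_le_pow hη (m := m) fun i hi => h i (Nat.lt_succ_of_lt hi)
      have hm : ‖P m - 1‖ ≤ η := h m m.lt_succ_self
      have h1 : 0 ≤ 1 + ‖P m - 1‖ := by positivity
      have hmul := mul_le_mul (by linarith : 1 + ‖oprod P m - 1‖ ≤ (1 + η) ^ m)
        (by linarith : 1 + ‖P m - 1‖ ≤ 1 + η) h1 (by positivity)
      calc ‖oprod P m * P m - 1‖ ≤ (1 + ‖oprod P m - 1‖) * (1 + ‖P m - 1‖) - 1 := mul_sub_one_norm_le _ _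
        _ ≤ (1 + η) ^ m * (1 + η) - 1 := by linarith

/-- Its LINEARISATION in the regime of the estimate (`m·η ≤ 1`): `‖oprod P m − 1‖ ≤ 2·m·η` — linear in the chain
length, as in the printed unitary case, at the price of the factor `2` (`(1 + η)^m ≤ e^{mη}` and `e^t − 1 ≤ 2t` on
`[0, 1]`, Mathlib's `Real.abs_exp_sub_one_le`). [folklore] -/
theorem norm_oprod_sub_one_le_two_mul {P : ℕ → R} {η : ℝ} (hη : 0 ≤ η) {m : ℕ}
    (hP : ∀ i < m, ‖P i - 1‖ ≤ η) (hm : (m : ℝ) * η ≤ 1) : ‖oprod P m - 1‖ ≤ 2 * (m * η) := by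
  have h0 : 0 ≤ (m : ℝ) * η := mul_nonneg (Nat.cast_nonneg m) hη
  have hlin : Real.exp (m * η) - 1 ≤ 2 * (m * η) := by
    have h := Real.abs_exp_sub_one_le (x := (m : ℝ) * η) (by rwa [abs_of_nonneg h0])
    rw [abs_of_nonneg h0] at h
    exact (le_abs_self _).trans h
  calc ‖oprod P m - 1‖ ≤ (1 + η) ^ m - 1 := norm_oprod_sub_one_le_pow hη hP
    _ ≤ Real.exp (m * η) - 1 := sub_le_sub_right (one_add_pow_le_exp hη m) 1
    _ ≤ 2 * (m * η) := hlin

/-- THE CONJUGATED CHAIN (complex exteriors): plaquette variables `p i` within `δ` of `1`, each seen through a gauge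
transformation `u i` of conjugation factor `‖u i‖‖(u i)⁻¹‖ ≤ Γ₂` ⇒ `‖oprod (u p u⁻¹) m − 1‖ ≤ (1 + Γ₂δ)^m − 1`.
[folklore] -/
theorem norm_oprod_conj_sub_one_le {p : ℕ → R} {u : ℕ → Rˣ} {δ Γ₂ : ℝ} (hδ : 0 ≤ δ) (hΓ : 0 ≤ Γ₂) {m : ℕ}
    (hp : ∀ i < m, ‖p i - 1‖ ≤ δ) (hu : ∀ i < m, ‖(u i : R)‖ * ‖(((u i)⁻¹ : Rˣ) : R)‖ ≤ Γ₂) :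
    ‖oprod (fun i => (u i : R) * p i * ↑(u i)⁻¹) m - 1‖ ≤ (1 + Γ₂ * δ) ^ m - 1 :=
  norm_oprod_sub_one_le_pow (mul_nonneg hΓ hδ) fun i hi =>
    (norm_conj_sub_one_le (u i) (p i)).trans (mul_le_mul (hu i hi) (hp i hi) (norm_nonneg _) hΓ)

/-- … and its linearisation: `‖oprod (u p u⁻¹) m − 1‖ ≤ 2·m·Γ₂·δ` while `m·Γ₂·δ ≤ 1`. [folklore] -/
theorem norm_oprod_conj_sub_one_le_two_mul {p : ℕ → R} {u : ℕ → Rˣ} {δ Γ₂ : ℝ} (hδ : 0 ≤ δ) (hΓ : 0 ≤ Γ₂)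
    {m : ℕ} (hp : ∀ i < m, ‖p i - 1‖ ≤ δ) (hu : ∀ i < m, ‖(u i : R)‖ * ‖(((u i)⁻¹ : Rˣ) : R)‖ ≤ Γ₂)
    (hm : (m : ℝ) * (Γ₂ * δ) ≤ 1) :
    ‖oprod (fun i => (u i : R) * p i * ↑(u i)⁻¹) m - 1‖ ≤ 2 * (m * (Γ₂ * δ)) :=
  norm_oprod_sub_one_le_two_mul (mul_nonneg hΓ hδ) (fun i hi =>
    (norm_conj_sub_one_le (u i) (p i)).trans (mul_le_mul (hu i hi) (hp i hi) (norm_nonneg _) hΓ)) hm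

/-- Monotonicity in the chain length: a bound for chains of length `≤ n` (all bonds of a region of diameter `n`).
[folklore] -/
theorem pow_sub_one_mono {η : ℝ} (hη : 0 ≤ η) {m n : ℕ} (h : m ≤ n) : (1 + η) ^ m - 1 ≤ (1 + η) ^ n - 1 :=
  sub_le_sub_right (pow_le_pow_right₀ (by linarith) h) 1

end Chain

/-! ## §4  Units and the constant's dependence (n = D/ξ bonds, plaquette bound α·(ξρ)², potential = bond deviation/ξ) -/

section Units

/-- BOOKKEEPING OF UNITS.  A region of diameter `D` (birth `ξ`-lattice units; `D = 100·M·R_j` in the cell's record) is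
crossed by chains of `n = D/ξ` bonds; a scale-`k` small-field configuration has plaquette bound `α·(ξρ)²` on the
`ξ`-lattice with `ρ = L^{−(k−j)}` its lattice spacing relative to the birth scale; the chained bond deviation is
`n·α(ξρ)²` and the axial POTENTIAL (bond deviation / ξ) is `D·α·ρ²`: LINEAR in `D`, quadratic in `ρ` (`ρ² = φ^{k−j}`,
`φ = L⁻²`), no other `L`-dependence. [folklore] -/
theorem chainDeviation_eq {D ξ α ρ : ℝ} (hξ : ξ ≠ 0) : D / ξ * (α * (ξ * ρ) ^ 2) / ξ = D * α * ρ ^ 2 := by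
  field_simp

/-- `ρ² = φ^{k−j}` with `ρ = L^{−(k−j)}`, `φ = L⁻²`. [folklore] -/
theorem inv_pow_sq_eq (L : ℝ) (n : ℕ) : (L⁻¹ ^ n) ^ 2 = (L ^ 2)⁻¹ ^ n := by
  rw [← inv_pow, ← pow_mul, ← pow_mul, mul_comm]

/-- DEV / RADIUS: dividing the potential deviation `C·D·α₀·φ^e` by the complex thickening `α₁` (the margin of the
segment-Cauchy step of §5) gives `C·D·(α₀/α₁)·φ^e` — the shape of `lip × dev` up to the sup of the mean field.
[folklore] -/
theorem devOverRadius_eq {C D α₀ α₁ φ : ℝ} {e : ℕ} (hα₁ : α₁ ≠ 0) :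
    C * D * (α₀ * φ ^ e) / α₁ = C * D * (α₀ / α₁) * φ ^ e := by
  field_simp

/-- LINEAR ≤ QUADRATIC once the diameter is `≥ 1`: `C·D·x ≤ C·D²·x`. [folklore] -/
theorem linear_le_quadratic {C D x : ℝ} (hC : 0 ≤ C) (hD : 1 ≤ D) (hx : 0 ≤ x) : C * D * x ≤ C * D ^ 2 * x := by
  have hD2 : D ≤ D ^ 2 := by nlinarith
  exact mul_le_mul_of_nonneg_right (mul_le_mul_of_nonneg_left hD2 hC) hx

/-- HAND-OFF TO THE SIBLING'S QUADRATIC SLOT: a LINEAR deviation bound `dev j ≤ α₀·(100·M·R_j)·φ^{K−j}` implies the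
hypothesis `hdev` of `T4FirstOrderSize.sizeShape_firstOrder` (`dev j ≤ α₀·(100·M·R_j)²·φ^{K−j}`) as soon as
`100·M·R_j ≥ 1`. [folklore] -/
theorem hdev_of_linear {K : ℕ} {α₀ M φ : ℝ} {dev R : ℕ → ℝ} (hα : 0 ≤ α₀) (hφ : 0 ≤ φ)
    (hMR : ∀ j, 1 ≤ 100 * M * R j) (hlin : ∀ j, dev j ≤ α₀ * (100 * M * R j) * φ ^ (K - j)) :
    ∀ j, dev j ≤ α₀ * (100 * M * R j) ^ 2 * φ ^ (K - j) := fun j =>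
  (hlin j).trans (linear_le_quadratic hα (hMR j) (pow_nonneg hφ _))

end Units

/-! ## §5  Supplying `T4FirstOrderSize.MeanLipschitz`: Cauchy along the real segment inside the analyticity tube -/

section Handoff

variable {𝒰 β F : Type*} [NormedAddCommGroup F] [NormedSpace ℂ F] [CompleteSpace F]

/-! HYPOTHESIS SHAPE "analytic segment" (used inline below, no new definition): a slice `g : ℂ → F`, complex
differentiable and bounded by `B` on a set `D` containing the closed `ϱ`-discs about every point of the real segment
`[0, 1]`, with `g 0 = m u₀ b` and `g 1 = m u b`.  Intended reading, NOT PRINTED: `g s` = the conditional mean at the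
exterior configuration `exp(iξ·s·A_u)` interpolating between the flat representative (`s = 0`) and the axial-gauge
representative of `u` (`s = 1`), analytically continued in `s`; the discs of radius `ϱ = α₁/‖A_u‖_∞` about `[0, 1]`
lie in the analyticity domain because `|Im s|·‖A_u‖_∞ ≤ α₁` is the printed complex thickening ([Balaban1987RG1]
(1.11)–(1.14) p. 262), while the real part `Re s·A_u` stays a real small-field potential. -/

/-- CAUCHY ALONG THE SEGMENT: an analytic slice bounded by `B` on the `ϱ`-discs about `[0, 1]` moves by at most `4B/ϱ`
between its endpoints — the kernel form `Dimock2015.real_param_lipschitz` (Cauchy's estimate on the discs of the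
margin, then the segment) at `s = 1, t = 0`. [folklore] -/
theorem norm_sub_le_of_segment {g : ℂ → F} {D : Set ℂ} {ϱ B : ℝ} (hϱ : 0 < ϱ) (hg : DifferentiableOn ℂ g D)
    (hB : ∀ z ∈ D, ‖g z‖ ≤ B) (hD : ∀ s ∈ Icc (0 : ℝ) 1, closedBall (s : ℂ) ϱ ⊆ D) : ‖g 1 - g 0‖ ≤ 4 * B / ϱ := by
  have h := Dimock2015.real_param_lipschitz (a := 0) (b := 1) hϱ hg hB hD (s := 1) (t := 0)
    ⟨zero_le_one, le_rfl⟩ ⟨le_rfl, zero_le_one⟩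
  simpa using h

/-- THE HAND-OFF.  If for every exterior configuration `u ∈ dom` with `dev u > 0` and every bond `b ∈ S` the values
`m u₀ b`, `m u b` are the endpoints of an analytic slice of margin `α₁ / dev u` bounded by `B`, and configurations with
`dev u = 0` have the flat means, then `MeanLipschitz dom m S u₀ dev (4B/α₁)`: `lip = 4·B/α₁` (B = sup of the mean
field on the analyticity tube, α₁ = its complex thickening) and `dev u` = whatever norm of the axial-gauge potential of
`u` makes the margin statement true — by §3–§4, LINEAR in the diameter of the region.  Every analytic input is a
hypothesis; nothing printed is asserted. [folklore] -/
theorem meanLipschitz_of_segment {dom : Set 𝒰} {m : 𝒰 → β → F} {S : Finset β} {u₀ : 𝒰} {dev : 𝒰 → ℝ}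
    {α₁ B : ℝ} (hα₁ : 0 < α₁) (hdev : ∀ u ∈ dom, 0 ≤ dev u)
    (hseg : ∀ u ∈ dom, 0 < dev u → ∀ b ∈ S, ∃ (g : ℂ → F) (D : Set ℂ), g 0 = m u₀ b ∧ g 1 = m u b ∧
      DifferentiableOn ℂ g D ∧ (∀ z ∈ D, ‖g z‖ ≤ B) ∧ ∀ s ∈ Icc (0 : ℝ) 1, closedBall (s : ℂ) (α₁ / dev u) ⊆ D)
    (hflat : ∀ u ∈ dom, dev u = 0 → ∀ b ∈ S, m u b = m u₀ b) :
    T4FirstOrderSize.MeanLipschitz dom m S u₀ dev (4 * B / α₁) := by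
  intro u hu b hb
  rcases (hdev u hu).eq_or_lt with h0 | hpos
  · rw [hflat u hu h0.symm b hb, sub_self, norm_zero, ← h0, mul_zero]
  · obtain ⟨g, D, hg0, hg1, hg, hB, hD⟩ := hseg u hu hpos b hb
    calc ‖m u b - m u₀ b‖ = ‖g 1 - g 0‖ := by rw [hg0, hg1]
      _ ≤ 4 * B / (α₁ / dev u) := norm_sub_le_of_segment (div_pos hα₁ hpos) hg hB hD
      _ = 4 * B / α₁ * dev u := by field_simp

/-- … and with a vanishing mean at the flat reference (`T4FirstOrderSize.MeanVanishes`, the reflection/covariance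
argument of the sibling modules) the CONDITIONAL-MEAN SUPPRESSION `‖m u b‖ ≤ (4B/α₁)·dev u` follows
(`T4FirstOrderSize.condMeanSuppression_of_flat`). [folklore] -/
theorem condMeanSuppression_of_segment {dom : Set 𝒰} {m : 𝒰 → β → F} {S : Finset β} {u₀ : 𝒰} {dev : 𝒰 → ℝ}
    {α₁ B : ℝ} (hα₁ : 0 < α₁) (hdev : ∀ u ∈ dom, 0 ≤ dev u) (h0 : T4FirstOrderSize.MeanVanishes S (m u₀))
    (hseg : ∀ u ∈ dom, 0 < dev u → ∀ b ∈ S, ∃ (g : ℂ → F) (D : Set ℂ), g 0 = m u₀ b ∧ g 1 = m u b ∧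
      DifferentiableOn ℂ g D ∧ (∀ z ∈ D, ‖g z‖ ≤ B) ∧ ∀ s ∈ Icc (0 : ℝ) 1, closedBall (s : ℂ) (α₁ / dev u) ⊆ D)
    (hflat : ∀ u ∈ dom, dev u = 0 → ∀ b ∈ S, m u b = m u₀ b) :
    T4FirstOrderSize.CondMeanSuppression dom m S dev (4 * B / α₁) :=
  T4FirstOrderSize.condMeanSuppression_of_flat h0 (meanLipschitz_of_segment hα₁ hdev hseg hflat)

/-- THE DEVIATION FROM THE CHAIN, end to end (abstract data): if the margin of `u` is controlled by a chained
axial-potential bound `dev u ≤ 2·n·η` (§3, `n` = the number of bonds across the region, `η` = conjugation factor ×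
plaquette bound) then `lip·dev u ≤ (4B/α₁)·(2nη)` — the product is LINEAR in `n`. [folklore] -/
theorem lipDev_le_linear {B α₁ η devu : ℝ} {n : ℕ} (hα₁ : 0 < α₁) (hB : 0 ≤ B) (hdev : devu ≤ 2 * (n * η)) :
    4 * B / α₁ * devu ≤ 4 * B / α₁ * (2 * (n * η)) :=
  mul_le_mul_of_nonneg_left hdev (by positivity)

end Handoff

end Literature.MathematicalPhysics.QuantumFieldTheory.Balaban1983to89.T4AxialChain
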